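import Literature.Analysis.FluidPDE.DistributionalToWeak
import HarnessLib

/-!
# The weak identity with initial datum, pressure kept

Analysis/FluidPDE support file (one theorem) over `DistributionalToWeak.lean`, whose
`weakIdentity_datum_of_distributional` performs the time cut-off argument producing the datum term
`∫ ⟪u₀, ψ(0)⟫` from a pressure-explicit distributional solution on the open slab `(0, T) × E`
attaining `u₀` in `L²_loc` (Robinson–Rodrigo–Sadowski 2016, §3.1, derivation of (3.1);
Caffarelli–Kohn–Nirenberg 1982, §2) — there for test fields with *divergence-free* slices, so that
the pressure disappears. Here the same argument is run for an **arbitrary** test field `ψ` on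
`(-∞, T) × E`, keeping the term `∫∫ p div ψ`, under the one extra hypothesis that the pressure is
integrable on the finite cylinders `(0, T) × K` up to `t = 0` (as it is for local Leray solutions,
`IsLocalLeraySolution.pressure`: `π ∈ L^{3/2}_loc(ℝ³ × [0, ∞))`):

  `∫₀ᵀ ∫ (⟪u, ∂ₜψ⟫ + ⟪u, (u·∇)ψ⟫ + ν⟪u, Δψ⟫ + p div ψ + ⟪f, ψ⟫) + ∫ ⟪u₀, ψ(0)⟫ = 0`

(`weakIdentity_datum_pressure_of_distributional`). Tested with `ψ(t, x) = η(t) φ(x)`, `η(0) ≠ 0`,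
this is the input of the du Bois-Reymond lemma with initial datum
(`Literature.Analysis.FunctionSpaces.ae_eq_add_setIntegral_of_forall_test`) giving the
time-sliced weak form *from `t = 0`* — `∫ ⟪u(t), φ⟫ = ∫ ⟪u₀, φ⟫ + ∫₀ᵗ ∫ (⟪u, (u·∇)φ⟫ + ν⟪u, Δφ⟫ +
p div φ)` for a.e. `t` — i.e. the weak equicontinuity at `t = 0` of local Leray solutions used in
the limiting procedure of Kikuchi–Seregin (Seregin 2014, App. B.4, (B.4.10)) and in Bradshaw–Tsai
2019, §4.3 (fact `bradshawTsai2019_limitDatum`).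

## References

* J. C. Robinson, J. L. Rodrigo, W. Sadowski, *The Three-Dimensional Navier–Stokes Equations*
  (CUP 2016), §3.1 (3.1) [RobinsonRodrigoSadowski2016].
* L. Caffarelli, R. Kohn, L. Nirenberg, CPAM 35 (1982), §2 (2.1)–(2.5)
  [CaffarelliKohnNirenberg1982].
* G. Seregin, *Lecture notes on regularity theory for the Navier–Stokes equations* (2014), App.
  B.4 (B.4.10) [Seregin2014Notes].
-/

noncomputable section

open MeasureTheory TopologicalSpace Set Function Filter Topology InnerProductSpace Metric
open scoped RealInnerProductSpace ENNReal NNReal Laplacian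

namespace Literature.Analysis.FluidPDE

variable {E : Type*} [NormedAddCommGroup E] [InnerProductSpace ℝ E] [FiniteDimensional ℝ E]
  [MeasurableSpace E] [BorelSpace E]
variable {T ν : ℝ} {f u : ℝ → E → E} {u₀ : E → E} {p : ℝ → E → ℝ}

/-- **The cut-off argument with the pressure kept.** Let `(u, p)` satisfy the pressure-explicit
identity against all test fields on the open slab `(0,T) × E`, with `u, ‖u‖²`, `f` **and `p`**
integrable on the finite cylinders `(0,T) × K`, a.e. slice of `u` measurable and locally `L²`, `u₀`
measurable, and `u(t) → u₀` in `L²_loc` as `t → 0⁺`. Then for **every** test field `ψ` on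
`(-∞, T) × E`
`∫₀ᵀ ∫ (⟪u, ∂ₜψ⟫ + ⟪u, (u·∇)ψ⟫ + ν ⟪u, Δψ⟫ + p div ψ + ⟪f, ψ⟫) + ∫ ⟪u₀, ψ(0)⟫ = 0`
(test with `η_δ(t) ψ(t, x)` and let `δ → 0`, exactly as in
`weakIdentity_datum_of_distributional`, the pressure term `∫∫ p η_δ div ψ` now converging to
`∫∫ p div ψ` by dominated convergence; Robinson–Rodrigo–Sadowski 2016, §3.1, derivation of (3.1)). [cite: RobinsonRodrigoSadowski2016, §3.1 p. 58 (3.1)] -/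
theorem weakIdentity_datum_pressure_of_distributional (hT : 0 < T)
    (hUK : ∀ K : Set E, IsCompact K → IntegrableOn (uncurry u) (Ioo 0 T ×ˢ K) volume ∧
      IntegrableOn (fun z => ‖uncurry u z‖ ^ 2) (Ioo 0 T ×ˢ K) volume)
    (hmom : ∀ ψ : ℝ → E → E, IsSpaceTimeTestOn (slab E (Ioo 0 T) isOpen_Ioo) ψ →
      ∫ z in Ioo 0 T ×ˢ (univ : Set E), (⟪u z.1 z.2, timeDeriv ψ z.1 z.2⟫ +
        ⟪u z.1 z.2, convect (u z.1) (ψ z.1) z.2⟫ + ν * ⟪u z.1 z.2, Δ (ψ z.1) z.2⟫ +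
        p z.1 z.2 * VectorCalculus.divergence (ψ z.1) z.2 + ⟪f z.1 z.2, ψ z.1 z.2⟫) = 0)
    (hf : ∀ K : Set E, IsCompact K → IntegrableOn (uncurry f) (Ioo 0 T ×ˢ K) volume)
    (hp : ∀ K : Set E, IsCompact K → IntegrableOn (uncurry p) (Ioo 0 T ×ˢ K) volume)
    (hgood : ∀ᵐ t ∂((volume : Measure ℝ).restrict (Ioo 0 T)),
      AEStronglyMeasurable (u t) (volume : Measure E) ∧
        ∀ n : ℕ, ∫⁻ x in closedBall (0 : E) n, ‖u t x‖ₑ ^ 2 < ∞)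
    (hm₀ : AEStronglyMeasurable u₀ (volume : Measure E))
    (h₀ : ∀ K : Set E, IsCompact K →
      Tendsto (fun t => ∫⁻ x in K, ‖u t x - u₀ x‖ₑ ^ 2) (𝓝[>] 0) (𝓝 0))
    {ψ : ℝ → E → E} (hψ : IsSpaceTimeTestOn (slab E (Iio T) isOpen_Iio) ψ) :
    (∫ t in Ioo 0 T, ∫ x, (⟪u t x, timeDeriv ψ t x⟫ + ⟪u t x, convect (u t) (ψ t) x⟫ +
        ν * ⟪u t x, Δ (ψ t) x⟫ + p t x * VectorCalculus.divergence (ψ t) x + ⟪f t x, ψ t x⟫)) +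
      ∫ x, ⟪u₀ x, ψ 0 x⟫ = 0 := by
  -- the compact `x`-shadow of `ψ`, enlarged to a closed ball `K`
  obtain ⟨K₀, hK₀, hK₀t⟩ := hψ.exists_compact_slice_subset
  obtain ⟨r, hr⟩ := hK₀.isBounded.subset_closedBall (0 : E)
  set n : ℕ := ⌈r⌉₊ with hn
  set K : Set E := closedBall (0 : E) n with hK_def
  have hK : IsCompact K := isCompact_closedBall _ _
  have hKt : ∀ t, tsupport (ψ t) ⊆ K := fun t =>
    (hK₀t t).trans (hr.trans (closedBall_subset_closedBall (Nat.le_ceil r)))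
  have hψ0 : ∀ t x, x ∉ K → ψ t x = 0 := fun t x hx =>
    image_eq_zero_of_notMem_tsupport fun h' => hx (hKt t h')
  -- regularity of the test-field ingredients as functions on `ℝ × E`
  have cψ : Continuous (uncurry ψ) := hψ.contDiff.continuous
  have cψ' : Continuous (uncurry (timeDeriv ψ)) := hψ.continuous_timeDeriv
  have cD : Continuous fun z : ℝ × E => fderiv ℝ (ψ z.1) z.2 := by
    have h := ((hψ.isSmoothSpaceTimeOn univ).fderiv_slice uniqueDiffOn_univ).continuousOn
    rw [univ_prod_univ, continuousOn_univ] at h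
    exact h
  have cL : Continuous fun z : ℝ × E => Δ (ψ z.1) z.2 := by
    have h := ((hψ.isSmoothSpaceTimeOn univ).laplacian uniqueDiffOn_univ).continuousOn
    rw [univ_prod_univ, continuousOn_univ] at h
    exact h
  have hψd : ∀ t, Differentiable ℝ (ψ t) := fun t =>
    (hψ.contDiff_slice t).differentiable (by simp)
  have hψ2 : ∀ t, ContDiff ℝ 2 (ψ t) := fun t => contDiff_infty.1 (hψ.contDiff_slice t) 2
  have hD0 : ∀ t x, x ∉ K → fderiv ℝ (ψ t) x = 0 := fun t x hx =>
    fderiv_of_notMem_tsupport ℝ fun h => hx (hKt t h)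
  have hL0 : ∀ t x, x ∉ K → Δ (ψ t) x = 0 := fun t x hx =>
    laplacian_eq_zero_of_notMem_tsupport fun h => hx (hKt t h)
  have hψ'0 : ∀ t x, x ∉ K → timeDeriv ψ t x = 0 := fun t x hx =>
    timeDeriv_eq_zero_of_forall (fun s => hψ0 s x hx) t
  -- the divergence of the slices: continuous, vanishing off `K`
  have ctr : Continuous fun L : E →L[ℝ] E => LinearMap.trace ℝ E (L : E →ₗ[ℝ] E) :=
    ((LinearMap.trace ℝ E).comp (ContinuousLinearMap.coeLM ℝ)).continuous_of_finiteDimensional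
  have cDiv : Continuous fun z : ℝ × E => VectorCalculus.divergence (ψ z.1) z.2 := ctr.comp cD
  have hDiv0 : ∀ t x, x ∉ K → VectorCalculus.divergence (ψ t) x = 0 := fun t x hx => by
    simp [VectorCalculus.divergence, hD0 t x hx]
  -- integrability on the slab
  obtain ⟨hUK1, hUK2⟩ := hUK K hK
  have iA : Integrable (fun z : ℝ × E => ⟪u z.1 z.2, timeDeriv ψ z.1 z.2⟫)
      (((volume : Measure ℝ).restrict (Ioo 0 T)).prod (volume : Measure E)) :=
    integrable_slab_inner hK hUK1 cψ' hψ'0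
  have iB : Integrable (fun z : ℝ × E => ⟪u z.1 z.2, convect (u z.1) (ψ z.1) z.2⟫)
      (((volume : Measure ℝ).restrict (Ioo 0 T)).prod (volume : Measure E)) :=
    integrable_slab_inner_clm_apply hK hUK1 hUK2 cD hD0
  have iC : Integrable (fun z : ℝ × E => ⟪u z.1 z.2, Δ (ψ z.1) z.2⟫)
      (((volume : Measure ℝ).restrict (Ioo 0 T)).prod (volume : Measure E)) :=
    integrable_slab_inner hK hUK1 cL hL0
  have iF : Integrable (fun z : ℝ × E => ⟪f z.1 z.2, ψ z.1 z.2⟫)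
      (((volume : Measure ℝ).restrict (Ioo 0 T)).prod (volume : Measure E)) :=
    integrable_slab_inner hK (hf K hK) cψ hψ0
  have iU : Integrable (fun z : ℝ × E => ⟪u z.1 z.2, ψ z.1 z.2⟫)
      (((volume : Measure ℝ).restrict (Ioo 0 T)).prod (volume : Measure E)) :=
    integrable_slab_inner hK hUK1 cψ hψ0
  -- the pressure term `p div ψ` is integrable
  have iP : Integrable (fun z : ℝ × E => p z.1 z.2 * VectorCalculus.divergence (ψ z.1) z.2)
      (((volume : Measure ℝ).restrict (Ioo 0 T)).prod (volume : Measure E)) := by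
    obtain ⟨CD, hCD0, hCD⟩ := exists_norm_le_of_continuous_of_eq_zero hK cDiv hDiv0 T
    rw [← volume_restrict_slab_eq]
    have hpK := hp K hK
    have h1 : IntegrableOn (fun z : ℝ × E => p z.1 z.2 * VectorCalculus.divergence (ψ z.1) z.2)
        (Ioo 0 T ×ˢ K) volume := by
      refine Integrable.mono' (hpK.norm.mul_const CD) (hpK.1.mul cDiv.aestronglyMeasurable) ?_
      filter_upwards [ae_restrict_mem (measurableSet_Ioo.prod hK.measurableSet)] with z hz
      rw [norm_mul]
      exact mul_le_mul_of_nonneg_left (hCD z ⟨hz.1, mem_univ _⟩) (norm_nonneg _)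
    refine h1.of_forall_sdiff_eq_zero (measurableSet_Ioo.prod MeasurableSet.univ) fun z hz => ?_
    have hz2 : z.2 ∉ K := fun h => hz.2 ⟨hz.1.1, h⟩
    obtain ⟨t, x⟩ := z
    simp [hDiv0 t x hz2]
  set Φ : ℝ × E → ℝ := fun z => ⟪u z.1 z.2, timeDeriv ψ z.1 z.2⟫ +
    ⟪u z.1 z.2, convect (u z.1) (ψ z.1) z.2⟫ + ν * ⟪u z.1 z.2, Δ (ψ z.1) z.2⟫ +
    p z.1 z.2 * VectorCalculus.divergence (ψ z.1) z.2 + ⟪f z.1 z.2, ψ z.1 z.2⟫ with hΦ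
  have iΦ : Integrable Φ (((volume : Measure ℝ).restrict (Ioo 0 T)).prod (volume : Measure E)) :=
    (((iA.add iB).add (iC.const_mul ν)).add iP).add iF
  -- the pairing `U(t) = ⟨u(t), ψ(t)⟩` and its a.e. limit at `0⁺`
  set U : ℝ → ℝ := fun t => ∫ x, ⟪u t x, ψ t x⟫ with hU_def
  set L : ℝ := ∫ x, ⟪u₀ x, ψ 0 x⟫ with hL_def
  have hUint : IntegrableOn U (Ioo 0 T) := iU.integral_prod_left
  have hgoodK : ∀ᵐ t ∂((volume : Measure ℝ).restrict (Ioo 0 T)),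
      AEStronglyMeasurable (u t) (volume : Measure E) ∧ ∫⁻ x in K, ‖u t x‖ₑ ^ 2 < ∞ := by
    filter_upwards [hgood] with t ht
    exact ⟨ht.1, ht.2 n⟩
  have hu₀ : ∫⁻ x in K, ‖u₀ x‖ₑ ^ 2 < ∞ := lintegral_datum_sq_lt_top hT hgoodK hm₀ (h₀ K hK)
  have hlim : ∀ ε > 0, ∃ τ > 0, ∀ᵐ t ∂((volume : Measure ℝ).restrict (Ioo 0 τ)), |U t - L| ≤ ε :=
    fun ε hε => exists_ae_abs_pairing_sub_datum_le hT hK hgoodK hm₀ hu₀ (h₀ K hK) cψ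
      hψ.hasCompactSupport hψ0 hε
  -- the cut-offs `η k` with derivatives `ρ k`, at scale `δ k = T / (6 (k + 1))`
  set δ : ℕ → ℝ := fun k => T / (6 * ((k : ℝ) + 1)) with hδ
  have hδ0 : ∀ k, 0 < δ k := fun k => by positivity
  have hδT : ∀ k, 3 * δ k ≤ T := fun k => by
    have hk : (0 : ℝ) ≤ k := Nat.cast_nonneg k
    have h1 : δ k ≤ T / 6 := by
      show T / (6 * ((k : ℝ) + 1)) ≤ T / 6
      exact div_le_div_of_nonneg_left hT.le (by norm_num) (by nlinarith)
    linarith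
  have hδlim : Tendsto δ atTop (𝓝 0) := by
    have h1 : Tendsto (fun k : ℕ => (k : ℝ) + 1) atTop atTop :=
      tendsto_atTop_add_const_right _ 1 tendsto_natCast_atTop_atTop
    have h2 : Tendsto (fun k : ℕ => 6 * ((k : ℝ) + 1)) atTop atTop :=
      h1.const_mul_atTop (by norm_num)
    exact tendsto_const_nhds.div_atTop h2
  obtain hcut : ∀ k, ∃ η ρ : ℝ → ℝ, ContDiff ℝ (⊤ : ℕ∞) η ∧ Continuous ρ ∧
      (∀ s, HasDerivAt η (ρ s) s) ∧ (∀ s, s ≤ δ k → η s = 0) ∧ (∀ s, 3 * δ k ≤ s → η s = 1) ∧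
      (∀ s, η s ∈ Icc (0 : ℝ) 1) ∧ (∀ s, 0 ≤ ρ s) ∧ (∀ s, s ∉ Ioo (δ k) (3 * δ k) → ρ s = 0) ∧
      ∫ s, ρ s = 1 := fun k => exists_smooth_time_cutoff (hδ0 k)
  choose η ρ hηs hρc hηρ hη0 hη1 hη01 hρ0 hρsupp hρ1 using hcut
  have hηabs : ∀ k s, |η k s| ≤ 1 := fun k s => by
    rw [abs_le]
    exact ⟨by linarith [(hη01 k s).1], (hη01 k s).2⟩
  have hρC : ∀ k, ∃ C, 0 ≤ C ∧ ∀ s, |ρ k s| ≤ C := fun k =>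
    exists_abs_le_of_eq_zero_off_Ioo (hρc k) (hρsupp k)
  -- Step 1: the tested identity for each `k`
  have hAB : ∀ k, (∫ z, η k z.1 * Φ z ∂(((volume : Measure ℝ).restrict (Ioo 0 T)).prod
      (volume : Measure E))) + ∫ t in Ioo 0 T, ρ k t * U t = 0 := by
    intro k
    obtain ⟨C, -, hC⟩ := hρC k
    have hψk : IsSpaceTimeTestOn (slab E (Ioo 0 T) isOpen_Ioo) (fun s x => η k s • ψ s x) :=
      hψ.cutoff (hδ0 k) (hηs k) (hη0 k)
    have key := hmom _ hψk
    have key' : ∫ z in Ioo 0 T ×ˢ (univ : Set E),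
        (ρ k z.1 * ⟪u z.1 z.2, ψ z.1 z.2⟫ + η k z.1 * Φ z) = 0 := by
      refine Eq.trans (setIntegral_congr_fun (measurableSet_Ioo.prod MeasurableSet.univ)
        fun z _ => ?_) key
      rw [hΦ]
      dsimp only
      rw [timeDeriv_cutoff (hηρ k) hψ.hasDerivAt_time, convect_fun_const_smul _ (hψd z.1 z.2),
        laplacian_fun_const_smul (hψ2 z.1), divergence_fun_const_smul (hψd z.1 z.2)]
      simp only [inner_add_right, real_inner_smul_right]
      ring
    have iρU : Integrable (fun z : ℝ × E => ρ k z.1 * ⟪u z.1 z.2, ψ z.1 z.2⟫)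
        (((volume : Measure ℝ).restrict (Ioo 0 T)).prod (volume : Measure E)) :=
      integrable_time_mul iU (hρc k) hC
    have iηΦ : Integrable (fun z : ℝ × E => η k z.1 * Φ z)
        (((volume : Measure ℝ).restrict (Ioo 0 T)).prod (volume : Measure E)) :=
      integrable_time_mul iΦ (hηs k).continuous (hηabs k)
    rw [volume_restrict_slab_eq, integral_add iρU iηΦ, integral_prod _ iρU] at key'
    simp only [integral_const_mul] at key'
    rw [add_comm]
    exact key'
  -- Step 2: the limits `k → ∞`
  have hA : Tendsto (fun k => ∫ z, η k z.1 * Φ z ∂(((volume : Measure ℝ).restrict (Ioo 0 T)).prod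
      (volume : Measure E))) atTop
      (𝓝 (∫ z, Φ z ∂(((volume : Measure ℝ).restrict (Ioo 0 T)).prod (volume : Measure E)))) := by
    refine tendsto_integral_of_dominated_convergence (fun z => ‖Φ z‖)
      (fun k => (integrable_time_mul iΦ (hηs k).continuous (hηabs k)).aestronglyMeasurable)
      iΦ.norm (fun k => Eventually.of_forall fun z => ?_) ?_
    · rw [norm_mul, Real.norm_eq_abs]
      exact mul_le_of_le_one_left (norm_nonneg _) (hηabs k z.1)
    · have hmem : ∀ᵐ z ∂(((volume : Measure ℝ).restrict (Ioo 0 T)).prod (volume : Measure E)),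
          z ∈ Ioo 0 T ×ˢ (univ : Set E) := by
        rw [← volume_restrict_slab_eq]
        exact ae_restrict_mem (measurableSet_Ioo.prod MeasurableSet.univ)
      filter_upwards [hmem] with z hz
      have hz1 : 0 < z.1 := hz.1.1
      have h3 : Tendsto (fun k => 3 * δ k) atTop (𝓝 0) := by
        simpa using hδlim.const_mul 3
      have hev : ∀ᶠ k in atTop, 3 * δ k < z.1 := (tendsto_order.1 h3).2 _ hz1
      refine (tendsto_const_nhds (x := Φ z)).congr' ?_
      filter_upwards [hev] with k hk
      rw [hη1 k z.1 hk.le, one_mul]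
  have hB : Tendsto (fun k => ∫ t in Ioo 0 T, ρ k t * U t) atTop (𝓝 L) :=
    tendsto_setIntegral_mul_of_ae_tendsto hUint hlim hδlim hδ0 hδT hρc hρ0 hρsupp hρ1
  have hsum : (∫ z, Φ z ∂(((volume : Measure ℝ).restrict (Ioo 0 T)).prod (volume : Measure E))) +
      L = 0 :=
    tendsto_nhds_unique (hA.add hB) (by simpa only [hAB] using tendsto_const_nhds)
  rw [integral_prod _ iΦ] at hsum
  exact hsum

end Literature.Analysis.FluidPDE

end
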